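import Literature.MathematicalPhysics.QuantumLattice.PairFieldMomentum

/-!
# Crux `WindowInfraredBound` (item `stmt-HubbardSuperconductivity-1089`): load-bearing hypotheses

Negative-side lemmas of the standing disprover (cdisprove cycle 1).  The crux bounds the WINDOW TAIL
`T_ε(ψ) = Σ_{m ≠ 0, |q_m| ≤ ε} S_ψ(m)` (`S_ψ(m) = pairStructureFactor dWaveFormFactor L ψ m =
‖Δ_d(m)ψ‖²/L²`) by `C ε L²` for every NORMALISED sector ground state.  Two of its syntactic features are
load-bearing in the strongest possible sense — dropping either turns the statement into an exact
VANISHING law for the pair field on ground states (no definition is introduced; the mutated statements are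
spelled out as hypotheses):

* `pairField_mulVec_eq_zero_of_withZeroMode` — with the zero mode `m = 0` admitted into the window, the
  statement forces `Δ_d ψ = pairField dWaveFormFactor L *ᵥ ψ = 0` for every normalised sector ground state of
  every large even torus at every `(U, δ)` (at fixed `L` the window always contains `m = 0`, so
  `S_ψ(0) ≤ C ε L²` for all `ε ∈ (0, ε₀]`).  The `m ≠ 0` cut is exactly what keeps the crux compatible with
  `k = 0` long-range order — it is an infrared bound AROUND the condensate, not on it.
* `pairFieldAt_mulVec_eq_zero_of_withoutNormalisation` — without `star ψ ⬝ᵥ ψ = 1` (ground states form a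
  cone, `isGroundStateInSector_smul`; the structure factor is quadratic, `pairStructureFactor_smul`) the
  statement forces `Δ_d(m) ψ = 0` for every window momentum `m ≠ 0`, `|q_m| ≤ ε₀`, on every ground state.

Neither consequence is refuted here (both speak about exact ground states of arbitrarily large doped
tori, which nothing in the tree controls), but either would contradict any nonzero pair amplitude; the
provers' statement must therefore use the normalisation and the momentum cut non-trivially.
Helpers: `eq_zero_of_le_mul_forall` (a nonnegative real `≤ Cε` for all small `ε` is `0`),
`pairStructureFactor_zero_le_windowSumWithZero`.  Workfile: `Cruxes/WindowInfraredBound/Disproof.lean`.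
-/

noncomputable section

namespace Summit.HubbardSuperconductivity.HubbardSuperconductivity.Theorems.WindowInfraredBound.Negative

open Literature.MathematicalPhysics.QuantumLattice Literature.Probability.LatticeModels Matrix Finset
open scoped ComplexOrder

variable (L : ℕ) [NeZero L]

/-! ### The zero mode: `m ≠ 0` is load-bearing -/

/-- The zero mode alone is below the window sum WITH the zero mode included (all terms are
nonnegative and `|q_0|² = 0 ≤ ε²`). [folklore] -/
theorem pairStructureFactor_zero_le_windowSumWithZero (ε : ℝ) (ψ : Fock (Orb (FermionTorus 2 L))) :
    pairStructureFactor dWaveFormFactor L ψ 0 ≤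
      ∑ m : TorusSite 2 L, if momentumNormSq L m ≤ ε ^ 2 then
        pairStructureFactor dWaveFormFactor L ψ m else 0 := by
  have h0 : (if momentumNormSq L (0 : TorusSite 2 L) ≤ ε ^ 2 then
      pairStructureFactor dWaveFormFactor L ψ 0 else 0) = pairStructureFactor dWaveFormFactor L ψ 0 := by
    rw [if_pos]; rw [momentumNormSq_zero]; exact sq_nonneg _
  rw [← h0]
  exact Finset.single_le_sum (f := fun m => if momentumNormSq L m ≤ ε ^ 2 then
      pairStructureFactor dWaveFormFactor L ψ m else 0)
    (fun m _ => by split_ifs <;> [exact pairStructureFactor_nonneg _ _ _ _; exact le_rfl])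
    (Finset.mem_univ _)

/-- A nonnegative real which is `≤ C ε` for every `ε ∈ (0, ε₀]` vanishes. [folklore] -/
theorem eq_zero_of_le_mul_forall {x C ε₀ : ℝ} (hx : 0 ≤ x) (hC : 0 ≤ C) (hε₀ : 0 < ε₀)
    (h : ∀ ε ∈ Set.Ioc (0:ℝ) ε₀, x ≤ C * ε) : x = 0 := by
  by_contra hne
  have hxpos : 0 < x := lt_of_le_of_ne hx (Ne.symm hne)
  set ε := min ε₀ (x / (2 * (C + 1))) with hεdef
  have hεpos : 0 < ε := lt_min hε₀ (by positivity)
  have hle := h ε ⟨hεpos, min_le_left _ _⟩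
  have h2 : C * ε ≤ C * (x / (2 * (C + 1))) := mul_le_mul_of_nonneg_left (min_le_right _ _) hC
  have h3 : C * (x / (2 * (C + 1))) < x := by
    rw [mul_div_assoc']
    rw [div_lt_iff₀ (by positivity)]
    nlinarith
  linarith

/-- **`m ≠ 0` is load-bearing (strongest form).** If the window sum is taken WITH the zero mode, the
statement forces `Δ_d ψ = 0` — exact vanishing of the `d`-wave pair field on EVERY normalised sector
ground state of EVERY large even torus at EVERY `(U, δ)`: at fixed `L` the window `|q_m| ≤ ε` always
contains `m = 0`, so `S_ψ(0) ≤ C ε L²` for all small `ε`, i.e. `‖Δ_d ψ‖² = 0`. (So that variant denies not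
only long-range order but any pair amplitude; the crux proper is insensitive to the `k = 0` condensate by
design.) [folklore] -/
theorem pairField_mulVec_eq_zero_of_withZeroMode
    (h : ∀ U : ℝ, 0 < U → ∀ δ ∈ Set.Ioo (0:ℝ) (1 / 2), ∃ C ε₀ : ℝ, 0 ≤ C ∧ 0 < ε₀ ∧ ∃ L₀ : ℕ,
      ∀ ε ∈ Set.Ioc (0:ℝ) ε₀, ∀ (L : ℕ) [NeZero L], L₀ ≤ L → Even L →
        ∀ ψ : Fock (Orb (FermionTorus 2 L)), star ψ ⬝ᵥ ψ = 1 →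
          IsGroundStateInSector (hubbardTorus 2 L 1 U) (2 * ⌊(1 - δ) * (L : ℝ) ^ 2 / 2⌋₊) 0 ψ →
            (∑ m : TorusSite 2 L, if momentumNormSq L m ≤ ε ^ 2 then
                pairStructureFactor dWaveFormFactor L ψ m else 0) ≤ C * ε * (L : ℝ) ^ 2) :
    ∀ U : ℝ, 0 < U → ∀ δ ∈ Set.Ioo (0:ℝ) (1 / 2), ∃ L₀ : ℕ, ∀ (L : ℕ) [NeZero L], L₀ ≤ L → Even L →
      ∀ ψ : Fock (Orb (FermionTorus 2 L)), star ψ ⬝ᵥ ψ = 1 →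
        IsGroundStateInSector (hubbardTorus 2 L 1 U) (2 * ⌊(1 - δ) * (L : ℝ) ^ 2 / 2⌋₊) 0 ψ →
          pairField dWaveFormFactor L *ᵥ ψ = 0 := by
  intro U hU δ hδ
  obtain ⟨C, ε₀, hC, hε₀, L₀, hmain⟩ := h U hU δ hδ
  refine ⟨L₀, fun L _ hL hev ψ hψ hgs => ?_⟩
  have hL2 : (0 : ℝ) < (L : ℝ) ^ 2 := by
    have := NeZero.pos L
    positivity
  -- `S_ψ(0) ≤ C ε L²` for every `ε ∈ (0, ε₀]`
  have hS : ∀ ε ∈ Set.Ioc (0:ℝ) ε₀,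
      pairStructureFactor dWaveFormFactor L ψ 0 ≤ C * (L : ℝ) ^ 2 * ε := fun ε hε =>
    ((pairStructureFactor_zero_le_windowSumWithZero L ε ψ).trans (hmain ε hε L hL hev ψ hψ hgs)).trans_eq
      (by ring)
  have h0 : pairStructureFactor dWaveFormFactor L ψ 0 = 0 :=
    eq_zero_of_le_mul_forall (pairStructureFactor_nonneg _ _ _ _) (by positivity) hε₀ hS
  -- `‖Δ_d ψ‖² / L² = 0`, hence `Δ_d ψ = 0`
  rw [pairStructureFactor_apply, pairFieldAt_zero, div_eq_zero_iff, or_iff_left hL2.ne'] at h0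
  have hre : star (pairField dWaveFormFactor L *ᵥ ψ) ⬝ᵥ (pairField dWaveFormFactor L *ᵥ ψ) = 0 := by
    have hnn := dotProduct_star_self_nonneg (pairField dWaveFormFactor L *ᵥ ψ)
    obtain ⟨hre0, him0⟩ := Complex.nonneg_iff.1 hnn
    exact Complex.ext (by simpa using h0) (by simpa using him0.symm)
  exact dotProduct_star_self_eq_zero.1 hre

/-! ### Normalisation: `star ψ ⬝ᵥ ψ = 1` is load-bearing -/

omit [NeZero L] in
/-- Ground states form a cone: `IsGroundStateInSector` is invariant under nonzero scalars. [folklore] -/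
theorem isGroundStateInSector_smul {H : Matrix (Finset (Orb (FermionTorus 2 L))) (Finset (Orb (FermionTorus 2 L))) ℂ}
    {N : ℕ} {M : ℝ} {ψ : Fock (Orb (FermionTorus 2 L))} (hψ : IsGroundStateInSector H N M ψ)
    {c : ℂ} (hc : c ≠ 0) : IsGroundStateInSector H N M (c • ψ) := by
  obtain ⟨hmem, hne, heig⟩ := hψ
  refine ⟨Submodule.smul_mem _ c hmem, smul_ne_zero hc hne, ?_⟩
  rw [Matrix.mulVec_smul, heig, smul_comm]

/-- The structure factor is quadratic: `S_{cψ}(m) = ‖c‖² S_ψ(m)`. [folklore] -/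
theorem pairStructureFactor_smul (g : Site 2 → ℝ) (c : ℂ) (ψ : Fock (Orb (FermionTorus 2 L)))
    (m : TorusSite 2 L) :
    pairStructureFactor g L (c • ψ) m = ‖c‖ ^ 2 * pairStructureFactor g L ψ m := by
  rw [pairStructureFactor_apply, pairStructureFactor_apply, Matrix.mulVec_smul, star_smul,
    smul_dotProduct, dotProduct_smul, smul_smul, smul_eq_mul, Complex.star_def,
    Complex.re_mul_ofReal_of_conj_mul_self c, mul_div_assoc]
  where
  /-- `Re ((conj c * c) * z) = ‖c‖² * Re z` -/
  Complex.re_mul_ofReal_of_conj_mul_self (c : ℂ) {z : ℂ} :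
      ((starRingEnd ℂ) c * c * z).re = ‖c‖ ^ 2 * z.re := by
    rw [Complex.conj_mul', ← Complex.ofReal_pow, Complex.re_ofReal_mul]

/-- **Normalisation is load-bearing.** If the bound is asked of EVERY sector ground state regardless of
its norm, scaling `ψ ↦ cψ` forces the window tail of every ground state to VANISH identically, i.e.
`Δ_d(m) ψ = 0` for every nonzero window momentum `m` (`|q_m| ≤ ε₀`) on every large even torus at every
`(U, δ)` — again a denial of any small-momentum pair amplitude, far beyond an infrared bound. [folklore] -/
theorem pairFieldAt_mulVec_eq_zero_of_withoutNormalisation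
    (h : ∀ U : ℝ, 0 < U → ∀ δ ∈ Set.Ioo (0:ℝ) (1 / 2), ∃ C ε₀ : ℝ, 0 ≤ C ∧ 0 < ε₀ ∧ ∃ L₀ : ℕ,
      ∀ ε ∈ Set.Ioc (0:ℝ) ε₀, ∀ (L : ℕ) [NeZero L], L₀ ≤ L → Even L →
        ∀ ψ : Fock (Orb (FermionTorus 2 L)),
          IsGroundStateInSector (hubbardTorus 2 L 1 U) (2 * ⌊(1 - δ) * (L : ℝ) ^ 2 / 2⌋₊) 0 ψ →
            (∑ m : TorusSite 2 L, if m ≠ 0 ∧ momentumNormSq L m ≤ ε ^ 2 then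
                pairStructureFactor dWaveFormFactor L ψ m else 0) ≤ C * ε * (L : ℝ) ^ 2) :
    ∀ U : ℝ, 0 < U → ∀ δ ∈ Set.Ioo (0:ℝ) (1 / 2), ∃ ε₀ : ℝ, 0 < ε₀ ∧ ∃ L₀ : ℕ,
      ∀ (L : ℕ) [NeZero L], L₀ ≤ L → Even L → ∀ ψ : Fock (Orb (FermionTorus 2 L)),
        IsGroundStateInSector (hubbardTorus 2 L 1 U) (2 * ⌊(1 - δ) * (L : ℝ) ^ 2 / 2⌋₊) 0 ψ →
          ∀ m : TorusSite 2 L, m ≠ 0 → momentumNormSq L m ≤ ε₀ ^ 2 →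
            pairFieldAt dWaveFormFactor L m *ᵥ ψ = 0 := by
  intro U hU δ hδ
  obtain ⟨C, ε₀, hC, hε₀, L₀, hmain⟩ := h U hU δ hδ
  refine ⟨ε₀, hε₀, L₀, fun L _ hL hev ψ hgs m hm hwin => ?_⟩
  have hL2 : (0 : ℝ) < (L : ℝ) ^ 2 := by
    have := NeZero.pos L
    positivity
  -- the window tail `T(ψ) := Σ_{m ≠ 0, window} S_ψ(m)` at `ε = ε₀`
  set T : Fock (Orb (FermionTorus 2 L)) → ℝ := fun φ =>
    ∑ m : TorusSite 2 L, if m ≠ 0 ∧ momentumNormSq L m ≤ ε₀ ^ 2 then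
      pairStructureFactor dWaveFormFactor L φ m else 0 with hTdef
  have hTnn : ∀ φ, 0 ≤ T φ := fun φ =>
    Finset.sum_nonneg fun m _ => by split_ifs <;> [exact pairStructureFactor_nonneg _ _ _ _; exact le_rfl]
  have hTsmul : ∀ (c : ℂ) φ, T (c • φ) = ‖c‖ ^ 2 * T φ := fun c φ => by
    simp only [hTdef, Finset.mul_sum]
    refine Finset.sum_congr rfl fun m _ => ?_
    split_ifs
    · exact pairStructureFactor_smul L dWaveFormFactor c φ m
    · exact (mul_zero _).symm
  -- scaling: `n² T(ψ) = T(n ψ) ≤ C ε₀ L²` for every natural `n ≥ 1`, hence `T ψ = 0`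
  have hbound : ∀ n : ℕ, ((n + 1 : ℕ) : ℝ) ^ 2 * T ψ ≤ C * ε₀ * (L : ℝ) ^ 2 := fun n => by
    have hc : ((n + 1 : ℕ) : ℂ) ≠ 0 := by exact_mod_cast Nat.succ_ne_zero n
    have := hmain ε₀ ⟨hε₀, le_rfl⟩ L hL hev (((n + 1 : ℕ) : ℂ) • ψ) (isGroundStateInSector_smul L hgs hc)
    rw [show (∑ m : TorusSite 2 L, if m ≠ 0 ∧ momentumNormSq L m ≤ ε₀ ^ 2 then
        pairStructureFactor dWaveFormFactor L (((n + 1 : ℕ) : ℂ) • ψ) m else 0) =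
        T (((n + 1 : ℕ) : ℂ) • ψ) from rfl, hTsmul, Complex.norm_natCast] at this
    exact this
  have hT0 : T ψ = 0 := by
    by_contra hne
    have hpos : 0 < T ψ := lt_of_le_of_ne (hTnn ψ) (Ne.symm hne)
    obtain ⟨n, hn⟩ := exists_nat_gt (C * ε₀ * (L : ℝ) ^ 2 / T ψ)
    have h1 := hbound n
    have h2 : C * ε₀ * (L : ℝ) ^ 2 < ((n + 1 : ℕ) : ℝ) ^ 2 * T ψ := by
      rw [div_lt_iff₀ hpos] at hn
      have hn1 : (n : ℝ) ≤ ((n + 1 : ℕ) : ℝ) ^ 2 := by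
        push_cast
        nlinarith
      nlinarith
    linarith
  -- a vanishing sum of nonnegative terms: the term at `m` vanishes
  have hterm : (if m ≠ 0 ∧ momentumNormSq L m ≤ ε₀ ^ 2 then
      pairStructureFactor dWaveFormFactor L ψ m else 0) = 0 := by
    have := (Finset.sum_eq_zero_iff_of_nonneg (s := Finset.univ) (fun m' _ => by
      split_ifs <;> [exact pairStructureFactor_nonneg dWaveFormFactor L ψ m'; exact le_rfl])).1 hT0 m
      (Finset.mem_univ m)
    exact this
  rw [if_pos ⟨hm, hwin⟩, pairStructureFactor_apply, div_eq_zero_iff, or_iff_left hL2.ne'] at hterm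
  have hre : star (pairFieldAt dWaveFormFactor L m *ᵥ ψ) ⬝ᵥ (pairFieldAt dWaveFormFactor L m *ᵥ ψ) = 0 := by
    have hnn := dotProduct_star_self_nonneg (pairFieldAt dWaveFormFactor L m *ᵥ ψ)
    obtain ⟨hre0, him0⟩ := Complex.nonneg_iff.1 hnn
    exact Complex.ext (by simpa using hterm) (by simpa using him0.symm)
  exact dotProduct_star_self_eq_zero.1 hre

end Summit.HubbardSuperconductivity.HubbardSuperconductivity.Theorems.WindowInfraredBound.Negative

end
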